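import Mathlib
import Summits.ResolutionOfSingularities.ResolutionOfSingularities.Theorems.SyzygyFlatteningDefs
import Summits.ResolutionOfSingularities.ResolutionOfSingularities.Theorems.LogCanQuotLU.Negative.Transport
import Literature.AlgebraicGeometry.Resolution.AffineDomainDimension
import HarnessLib

/-!
# `stub_syzygyIndex_pos` — the crux hypotheses force `tr.deg_k K ≥ 1`

Crux `SyzygyFlattening.RankOneTermination` (stmt-ResolutionOfSingularities-17044), line `birth`,
registered stub `stub_syzygyIndex_pos` — PROVED: for an affine model `A` of `K/k` (`A.FG`,
`Frac A = K`) inside a valuation ring `O ⊇ k` of `K` with `ringKrullDim O = 1`, the syzygy index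
`n = syzygyIndex k K = Cardinal.toNat (tr.deg_k K)` is at least `1`.

Proof.  `A` is a finitely generated `k`-domain, so `tr.deg_k A = N` for a natural number `N`
(tree `exists_ringKrullDim_eq_and_trdeg_eq`, Matsumura Thm. 5.6) and `tr.deg_k K = tr.deg_k A`
(`Frac A = K`, tree `trdeg_eq_trdeg_of_isFractionRing`), hence `syzygyIndex k K = N`
(`Cardinal.toNat_natCast`).  If `N = 0` then `K/k` is algebraic (Mathlib `trdeg_eq_zero_iff`),
so every `y : K` is integral over `k ⊆ O`, hence in `O` (the ring of integers of a valuation is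
integrally closed in `K`; tree `LogCanQuotLU.Negative.mem_of_isIntegral`); so `O = K` is a field
and `ringKrullDim O = 0`,
contradicting `ringKrullDim O = 1`.  The hypothesis `A ⊆ O` of the registered signature is not
used (only `k ⊆ O` is).
-/

noncomputable section

-- single-problem summit: the doubled namespace component `ResolutionOfSingularities` is forced
set_option linter.dupNamespace false

namespace Summit.ResolutionOfSingularities.ResolutionOfSingularities.Theorems.SyzygyFlattening

open Literature.AlgebraicGeometry.Resolution

section syzygyIndexPos

variable {k K : Type} [Field k] [Field K] [Algebra k K]

/-- A valuation ring of `K` containing all of `K` is a field. [folklore] -/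
theorem syzygyIndexPos_isField_of_forall_mem (O : ValuationSubring K) (hall : ∀ y : K, y ∈ O) :
    IsField ↥O := by
  refine ⟨⟨0, 1, zero_ne_one⟩, mul_comm, fun {a} ha => ?_⟩
  have ha' : (a : K) ≠ 0 := fun h => ha (ZeroMemClass.coe_eq_zero.mp h)
  exact ⟨⟨(a : K)⁻¹, hall _⟩, Subtype.ext (mul_inv_cancel₀ ha')⟩

/-- For an affine model `A` of `K/k` (`A` finitely generated, `Frac A = K`) the transcendence
degree `tr.deg_k K` is a natural number. [cite: Matsumura1987, Thm. 5.6] -/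
theorem syzygyIndexPos_exists_trdeg_eq_nat (A : Subalgebra k K) (hFG : A.FG)
    (hFrac : IsFractionRing ↥A K) : ∃ N : ℕ, Algebra.trdeg k K = N := by
  haveI : Algebra.FiniteType k ↥A := A.fg_iff_finiteType.mp hFG
  haveI := hFrac
  obtain ⟨N, -, htr⟩ := exists_ringKrullDim_eq_and_trdeg_eq k ↥A
  exact ⟨N, by rw [trdeg_eq_trdeg_of_isFractionRing A, htr]⟩

/-- If `K/k` is algebraic, a valuation ring `O ⊇ k` of `K` is all of `K`, hence a field, hence
of Krull dimension `0`. [cite: ZariskiSamuel1960, VI §10] -/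
theorem syzygyIndexPos_ringKrullDim_eq_zero_of_isAlgebraic (O : ValuationSubring K)
    (hk : ∀ c : k, algebraMap k K c ∈ O) [Algebra.IsAlgebraic k K] : ringKrullDim ↥O = 0 := by
  refine ringKrullDim_eq_zero_of_isField (syzygyIndexPos_isField_of_forall_mem O fun y => ?_)
  exact LogCanQuotLU.Negative.mem_of_isIntegral O hk (Algebra.IsAlgebraic.isAlgebraic y).isIntegral

/-- **STUB `stub_syzygyIndex_pos`.** Under the crux hypotheses the syzygy index
`n = tr.deg_k K` (as a natural number) is at least `1`: `A` is finitely generated with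
`Frac A = K`, so `tr.deg_k K = tr.deg_k A` is a natural number `N` and `syzygyIndex k K = N`; if
`N = 0`, `K` is algebraic over `k ⊆ O`, hence `K ⊆ O` (valuation rings are integrally closed),
`O = K` is a field and `ringKrullDim O = 0`, contradicting `ringKrullDim O = 1`.
[cite: ZariskiSamuel1960, VI §10] -/
theorem stub_syzygyIndex_pos : ∀ (k K : Type) [Field k] [Field K] [Algebra k K]
    (O : ValuationSubring K) (A : Subalgebra k K), (∀ c : k, algebraMap k K c ∈ O) → A.FG →
      IsFractionRing ↥A K → A.toSubring ≤ O.toSubring → ringKrullDim ↥O = 1 →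
      1 ≤ syzygyIndex k K := by
  intro k K _ _ _ O A hk hFG hFrac _ hdim
  obtain ⟨N, hN⟩ := syzygyIndexPos_exists_trdeg_eq_nat A hFG hFrac
  have hn : syzygyIndex k K = N := by
    unfold syzygyIndex
    rw [hN, Cardinal.toNat_natCast]
  rw [hn]
  by_contra hlt
  have hN0 : N = 0 := by omega
  rw [hN0, Nat.cast_zero] at hN
  haveI : Algebra.IsAlgebraic k K := trdeg_eq_zero_iff.mp hN
  have h0 := syzygyIndexPos_ringKrullDim_eq_zero_of_isAlgebraic O hk
  rw [hdim] at h0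
  exact one_ne_zero h0

end syzygyIndexPos

end Summit.ResolutionOfSingularities.ResolutionOfSingularities.Theorems.SyzygyFlattening

end
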